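import Literature.Analysis.FluidPDE.Axisymmetric
import HarnessLib

/-!
# Chen–Strain–Tsai–Yau 2009: no axisymmetric blow-up under a mixed scale-critical envelope

Topic `Literature/Analysis/FluidPDE`; ONE named fact (a result in print that the tree has not
proved, `def … : Prop`, D-0014) with small proved API, typed for the blow-up scenario census
(`pub/ns-census`, row **F2m** of `SCENARIO-CENSUS.md`: «axisymmetric × MIXED scale-critical
envelope `|v| ≤ C_* r^{-1+ε}|t|^{-ε/2}`, `0 < ε < 1` ⇒ bounded up to the singular time»,
EXCLUDED-IN-PRINT-NOT-TREE; the tree types and proves only the two ENDPOINTS `ε = 1` (the Type I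
time rate) and `ε = 0` (`r|u| ≤ C`) as `knss_no_axisymmetric_typeI` / `…_holds`, `Axisymmetric.lean`,
whose docstring already names this theorem; the barrier card
`Literature.Barriers.NavierStokesRegularity.AxisymmetricTypeIExclusion`, `scope_caveats` (a), lists
the mixed variant as «print-only»).

C.-C. Chen, R. M. Strain, T.-P. Tsai, H.-T. Yau, *Lower bounds on the blow-up rate of the
axisymmetric Navier–Stokes equations II*, Comm. PDE 34 (2009) 203–232 = arXiv:0709.4230, §1
(held text `paper:arxiv-0709.4230`, chunk p0003 L41–68; `ν = 1`, no force, (N-S) on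
`D = ℝ³ × (-T₀, 0)`):

> **Theorem 1.1.** Let `(v, p)` be an axisymmetric strong solution of the Navier–Stokes equations
> (N-S) in `D = ℝ³ × (-T₀, 0)` with initial datum `v|_{t=-T₀} = v⁰ ∈ H^{1/2}` and
> `r v⁰_θ(r, z) ∈ L^∞`. Suppose the pressure satisfies `p ∈ L^{5/3}(D)` and `v` is pointwise
> bounded by one of the following inequalities:
> (1.3) `|v(x, t)| ≤ C_* |t|^{-1/2}`, `(x, t) ∈ D`;
> (1.4) there is an `ε ∈ [0, 1]` such that `|v(x, t)| ≤ C_* r^{-1+ε} |t|^{-ε/2}`, `(x, t) ∈ D`.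
> The constant `C_* < ∞` is allowed to be large. Then `v ∈ L^∞(B_R × [-T₀, 0])` for any `R > 0`.

(Ibid.: "the case `ε = 0` is addressed in the appendix; our proof in that specific case was
obtained after a preprint of [KNSS] had appeared. The assumption (1.3) is a special case of (1.4)
with `ε = 1`"; "the exponent `5/3` for the norm of `p` can be replaced, but it is the natural
exponent occurring in the existence theory for weak solutions".)

* `ChenStrainTsaiYau2009_mixedEnvelope_regular` — **Theorem 1.1, alternative (1.4)** (which
  contains (1.3) as `ε = 1`) as a named fact.

## Rendering (a special case of the printed statement, never stronger)

Exactly the rendering of the neighbouring forward axisymmetric criteria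
`Zhang2026_partialTypeI_regularity` (`ZhangPartialTypeI.lean`) and
`knss_no_axisymmetric_typeI` (`Axisymmetric.lean`), in the FORWARD clock (print's `t ∈ (-T₀, 0)`
is `t - T`, `t ∈ (0, T)`, `T = T₀`; the equations are translation invariant in time):
a classical solution `(u, p)` of Navier–Stokes (`ν = 1`, `f = 0`, as printed) on `[0, T) × ℝ³`
(`IsClassicalNSSolutionOn (Ico 0 T) 1 0 u p`) which is Leray–Hopf on `[0, T)` from its datum
(`IsLerayHopfOn T 1 0 (u 0) u`), the datum rapidly decaying (`HasRapidSpatialDecay (u 0)`,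
Fefferman's class).  This is a SUBCLASS of the printed «strong solution with `v⁰ ∈ H^{1/2}`»: a
smooth rapidly decaying datum lies in every `H^s`, and the classical finite-energy solution it
generates coincides on `[0, T)` with the strong (Fujita–Kato) solution by weak–strong uniqueness,
so the printed theorem applies to it.  Every slice `u t`, `0 ≤ t < T`, is axisymmetric about the
`x₂`-axis (`IsAxisymmetric`; print: "axisymmetric … solution").  The hypothesis `r v⁰_θ ∈ L^∞` is
kept verbatim as `‖Γ₀‖_{L^∞} < ∞`, `Γ₀ = swirl (u 0) = r u_θ(·, 0)` (junk-free polynomial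
`x₀ u₁ - x₁ u₀`; automatic for rapidly decaying data, but printed, so kept), and `p ∈ L^{5/3}(D)`
verbatim as `MemLp (uncurry p) (5/3)` on `(0, T) × ℝ³` (the tree's pressure is any smooth
gradient potential in the momentum equation, so this integrability is a genuine normalisation
hypothesis, as in print).  The envelope (1.4) is written JUNK-FREE in product form,
`r^{1-ε} (T - t)^{ε/2} |u(x, t)| ≤ C` for all `x ∈ ℝ³`, `t ∈ (0, T)` (print's open `D`): off the
axis and for `t < T` this is literally `|u| ≤ C r^{-1+ε} (T - t)^{-ε/2}`; ON the axis, for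
`ε < 1`, `Real.rpow` gives `0^{1-ε} = 0` and the condition is vacuous — exactly as the printed
right-hand side `C_* 0^{-1+ε} = +∞` — while for `ε = 1`, `0^0 = 1` and the condition is the
time rate `(T - t)^{1/2}|u| ≤ C` at every point, i.e. (1.3) (`hasMixedEnvelope_one_iff`).  The exponent is a
parameter `ε ∈ [0, 1]` and the constant `C` is arbitrary ("allowed to be large").  The conclusion
`v ∈ L^∞(B_R × [-T₀, 0])` for every `R > 0` is rendered pointwise for the continuous `u`:
**for every `R > 0`, `u` is bounded on `[0, T) × B_R`**.  (The continuation of the solution past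
`T`, which the census reads off, is NOT asserted here: it needs in addition boundedness near
`t = T` at spatial infinity, a separate printed input — cf. `typeI_boundedNearTop_infinity` in
`AxisymmetricTypeIBounded.lean` for the Type I endpoint.)

Proved here: the two endpoint embeddings documenting the interpolation — the time rate
`|u| ≤ C/√(T - t)` is the envelope with `ε = 1` (`envelope_of_timeRate`, print: "(1.3) is a
special case of (1.4) with `ε = 1`") and the axis bound `r|u| ≤ C` is the envelope with `ε = 0`
(`envelope_of_axisBound`) — and the applied form `….bounded`.

Not restated: the intermediate estimate (1.5) `|v| ≤ C_*(r² - t)^{-1/2+2ε}|t|^{-ε}r^{-2ε}`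
(§§2–3), the De Giorgi–Nash–Moser Hölder estimate for `Γ = r v_θ` (§§4–5), the appendix
(`ε = 0`).

## Mathlib / tree search

Mathlib has no Navier–Stokes theory.  `lean search 'ChenStrainTsaiYau|mixedEnvelope|CSTY2009'
--decl`: no declaration (2026-08-28); `rg 0709.4230` in the tree: cited only in `Axisymmetric.lean`
(docstring of `knss_no_axisymmetric_typeI`, endpoints) and in the barrier card
`AxisymmetricTypeIExclusion.lean` («print-only»).  Reused: `IsClassicalNSSolutionOn`
(`ClassicalSolution.lean`); `IsLerayHopfOn` (`LerayHopf.lean`); `HasRapidSpatialDecay`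
(`NSWave0.lean`); `IsAxisymmetric`, `swirl`, `cylRadius` (`AxisymmetricEuler.lean`) — all through
`Axisymmetric.lean`.

## References

* C.-C. Chen, R. M. Strain, T.-P. Tsai, H.-T. Yau, *Lower bounds on the blow-up rate of the
  axisymmetric Navier–Stokes equations II*, Comm. PDE 34 (2009) 203–232 = arXiv:0709.4230,
  Thm. 1.1 (§1) and the remarks after it. [`ChenStrainTsaiYau2009`]
* C.-C. Chen, R. M. Strain, H.-T. Yau, T.-P. Tsai, *Lower bound on the blow-up rate of the
  axisymmetric Navier–Stokes equations*, IMRN 2008 = arXiv:math/0701796, Thm. 1.1 (the envelope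
  `|v| ≤ C_*(r² - t)^{-1/2}`). [`ChenStrainYauTsai2008`]
* G. Koch, N. Nadirashvili, G. Seregin, V. Šverák, Acta Math. 203 (2009), Thms. 6.1–6.2;
  G. Seregin, V. Šverák, Comm. PDE 34 (2009), Thms. 1.1–1.2 (the endpoints, tree:
  `knss_no_axisymmetric_typeI_holds`). [`KochNadirashviliSereginSverak2009`, `SereginSverak2009`]
-/

noncomputable section

open MeasureTheory Set Function Filter Topology TopologicalSpace
open scoped NNReal ENNReal RealInnerProductSpace

namespace Literature.Analysis.FluidPDE

/-! ### The mixed scale-critical envelope -/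

/-- **The envelope (1.4) of Chen–Strain–Tsai–Yau 2009 in junk-free product form**, forward clock
with singular time `T`: `r^{1-ε} (T - t)^{ε/2} |u(x, t)| ≤ C` for all `x` and all `t ∈ (0, T)`
(off the axis: `|u(x, t)| ≤ C r^{-1+ε} (T - t)^{-ε/2}`; vacuous on the axis when `ε < 1`, the
time rate `(T - t)^{1/2}|u| ≤ C` everywhere when `ε = 1`).
[cite: ChenStrainTsaiYau2009, Thm. 1.1 (1.4) (arXiv:0709.4230 §1)] -/
def HasMixedEnvelope (ε C T : ℝ)
    (u : ℝ → EuclideanSpace ℝ (Fin 3) → EuclideanSpace ℝ (Fin 3)) : Prop :=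
  ∀ t ∈ Ioo 0 T, ∀ x : EuclideanSpace ℝ (Fin 3),
    cylRadius x ^ (1 - ε) * (T - t) ^ (ε / 2) * ‖u t x‖ ≤ C

/-- Unfolding `HasMixedEnvelope`. [cite: ChenStrainTsaiYau2009, Thm. 1.1 (1.4)] -/
theorem hasMixedEnvelope_iff {ε C T : ℝ}
    {u : ℝ → EuclideanSpace ℝ (Fin 3) → EuclideanSpace ℝ (Fin 3)} :
    HasMixedEnvelope ε C T u ↔ ∀ t ∈ Ioo 0 T, ∀ x : EuclideanSpace ℝ (Fin 3),
      cylRadius x ^ (1 - ε) * (T - t) ^ (ε / 2) * ‖u t x‖ ≤ C :=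
  Iff.rfl

/-- **`ε = 1`: the envelope is the Type I time rate** `√(T - t) |u(x, t)| ≤ C` at every point of
`(0, T) × ℝ³` (print: "(1.3) is a special case of (1.4) with `ε = 1`"; in Lean `r^0 = 1` also on
the axis). [cite: ChenStrainTsaiYau2009, Thm. 1.1, remark after (1.4)] -/
theorem hasMixedEnvelope_one_iff {C T : ℝ}
    {u : ℝ → EuclideanSpace ℝ (Fin 3) → EuclideanSpace ℝ (Fin 3)} :
    HasMixedEnvelope 1 C T u ↔
      ∀ t ∈ Ioo 0 T, ∀ x : EuclideanSpace ℝ (Fin 3), Real.sqrt (T - t) * ‖u t x‖ ≤ C := by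
  simp only [HasMixedEnvelope, sub_self, Real.rpow_zero, one_mul, Real.sqrt_eq_rpow]

/-- **`ε = 0`: the envelope is the axis bound** `r |u(x, t)| ≤ C` on `(0, T) × ℝ³` (the case of
the appendix of the paper, after KNSS 2009 Thm. 6.1).
[cite: ChenStrainTsaiYau2009, Thm. 1.1, remark after (1.4) (case ε = 0, appendix)] -/
theorem hasMixedEnvelope_zero_iff {C T : ℝ}
    {u : ℝ → EuclideanSpace ℝ (Fin 3) → EuclideanSpace ℝ (Fin 3)} :
    HasMixedEnvelope 0 C T u ↔
      ∀ t ∈ Ioo 0 T, ∀ x : EuclideanSpace ℝ (Fin 3), cylRadius x * ‖u t x‖ ≤ C := by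
  simp only [HasMixedEnvelope, sub_zero, Real.rpow_one, zero_div, Real.rpow_zero, mul_one]

/-- **The Type I time rate gives the envelope with `ε = 1`**: if `|u(x, t)| ≤ C/√(T - t)` on
`(0, T) × ℝ³` then `HasMixedEnvelope 1 C T u`.
[cite: ChenStrainTsaiYau2009, Thm. 1.1, (1.3) ⊂ (1.4)] -/
theorem envelope_of_timeRate {C T : ℝ}
    {u : ℝ → EuclideanSpace ℝ (Fin 3) → EuclideanSpace ℝ (Fin 3)}
    (h : ∀ t ∈ Ioo 0 T, ∀ x : EuclideanSpace ℝ (Fin 3), ‖u t x‖ ≤ C / Real.sqrt (T - t)) :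
    HasMixedEnvelope 1 C T u := by
  rw [hasMixedEnvelope_one_iff]
  intro t ht x
  have hpos : 0 < Real.sqrt (T - t) := Real.sqrt_pos.mpr (by linarith [ht.2])
  have := h t ht x
  rw [le_div_iff₀ hpos] at this
  linarith [mul_comm (Real.sqrt (T - t)) ‖u t x‖]

/-- **The axis bound gives the envelope with `ε = 0`**: if `r |u(x, t)| ≤ C` on `[0, T) × ℝ³`
(the second alternative of `knss_no_axisymmetric_typeI`) then `HasMixedEnvelope 0 C T u`.
[cite: ChenStrainTsaiYau2009, Thm. 1.1, case ε = 0] -/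
theorem envelope_of_axisBound {C T : ℝ}
    {u : ℝ → EuclideanSpace ℝ (Fin 3) → EuclideanSpace ℝ (Fin 3)}
    (h : ∀ t ∈ Ico 0 T, ∀ x : EuclideanSpace ℝ (Fin 3), cylRadius x * ‖u t x‖ ≤ C) :
    HasMixedEnvelope 0 C T u := by
  rw [hasMixedEnvelope_zero_iff]
  exact fun t ht x => h t ⟨ht.1.le, ht.2⟩ x

/-! ### The named fact -/

/-- **Chen–Strain–Tsai–Yau 2009, Theorem 1.1 (axisymmetric solutions under the mixed
scale-critical envelope are bounded up to the singular time).**  "Let `(v, p)` be an axisymmetric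
strong solution of (N-S) in `D = ℝ³ × (-T₀, 0)` with initial datum `v⁰ ∈ H^{1/2}` and
`r v⁰_θ ∈ L^∞`. Suppose `p ∈ L^{5/3}(D)` and, for some `ε ∈ [0, 1]`,
`|v(x, t)| ≤ C_* r^{-1+ε} |t|^{-ε/2}` on `D`, `C_* < ∞` allowed to be large. Then
`v ∈ L^∞(B_R × [-T₀, 0])` for any `R > 0`" (`ν = 1`, no force).  Rendered (module docstring) in
the forward clock for a classical solution on `[0, T) × ℝ³` which is Leray–Hopf on `[0, T)` from a
rapidly decaying datum (a subclass of the printed strong solutions), with axisymmetric slices,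
`‖swirl (u 0)‖_{L^∞} < ∞`, `p ∈ L^{5/3}((0, T) × ℝ³)`, and the envelope `HasMixedEnvelope ε C T u`
for a parameter `ε ∈ [0, 1]` and any constant `C`; conclusion: for every `R > 0`, `u` is bounded on
`[0, T) × B_R`.  The endpoints `ε = 1`, `ε = 0` are the tree's `knss_no_axisymmetric_typeI`
(proved); the mixed exponents `0 < ε < 1` are in print only.
[cite: ChenStrainTsaiYau2009, Thm. 1.1 (arXiv:0709.4230 §1, (1.4)) with the remarks after it] -/
def ChenStrainTsaiYau2009_mixedEnvelope_regular : Prop :=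
  ∀ (ε C T : ℝ), 0 ≤ ε → ε ≤ 1 → 0 < T →
    ∀ (u : ℝ → EuclideanSpace ℝ (Fin 3) → EuclideanSpace ℝ (Fin 3))
      (p : ℝ → EuclideanSpace ℝ (Fin 3) → ℝ),
    IsClassicalNSSolutionOn (Ico 0 T) 1 0 u p → IsLerayHopfOn T 1 0 (u 0) u →
    HasRapidSpatialDecay (u 0) → (∀ t ∈ Ico 0 T, IsAxisymmetric (u t)) →
    eLpNorm (swirl (u 0)) ∞ volume < ∞ →
    MemLp (uncurry p) (5 / 3)
      (volume.restrict (Ioo 0 T ×ˢ (univ : Set (EuclideanSpace ℝ (Fin 3))))) →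
    HasMixedEnvelope ε C T u →
    ∀ R : ℝ, 0 < R → ∃ M : ℝ, ∀ t ∈ Ico 0 T,
      ∀ x ∈ Metric.ball (0 : EuclideanSpace ℝ (Fin 3)) R, ‖u t x‖ ≤ M

/-! ### API -/

namespace ChenStrainTsaiYau2009_mixedEnvelope_regular

variable {u : ℝ → EuclideanSpace ℝ (Fin 3) → EuclideanSpace ℝ (Fin 3)}
  {p : ℝ → EuclideanSpace ℝ (Fin 3) → ℝ} {ε C T : ℝ}

/-- The fact applied: under the printed hypotheses the velocity is bounded on `[0, T) × B_R` for
every `R > 0`. [cite: ChenStrainTsaiYau2009, Thm. 1.1] -/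
theorem bounded (h : ChenStrainTsaiYau2009_mixedEnvelope_regular) (hε₀ : 0 ≤ ε) (hε₁ : ε ≤ 1)
    (hT : 0 < T) (hcl : IsClassicalNSSolutionOn (Ico 0 T) 1 0 u p)
    (hLH : IsLerayHopfOn T 1 0 (u 0) u) (hdec : HasRapidSpatialDecay (u 0))
    (hax : ∀ t ∈ Ico 0 T, IsAxisymmetric (u t)) (hΓ : eLpNorm (swirl (u 0)) ∞ volume < ∞)
    (hp : MemLp (uncurry p) (5 / 3)
      (volume.restrict (Ioo 0 T ×ˢ (univ : Set (EuclideanSpace ℝ (Fin 3))))))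
    (henv : HasMixedEnvelope ε C T u) {R : ℝ} (hR : 0 < R) :
    ∃ M : ℝ, ∀ t ∈ Ico 0 T, ∀ x ∈ Metric.ball (0 : EuclideanSpace ℝ (Fin 3)) R, ‖u t x‖ ≤ M :=
  h ε C T hε₀ hε₁ hT u p hcl hLH hdec hax hΓ hp henv R hR

/-- **The time-rate endpoint** (print's alternative (1.3)): under the printed hypotheses and
`|u(x, t)| ≤ C/√(T - t)` on `(0, T) × ℝ³`, `u` is bounded on `[0, T) × B_R` for every `R > 0`.
[cite: ChenStrainTsaiYau2009, Thm. 1.1 (1.3)] -/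
theorem bounded_of_timeRate (h : ChenStrainTsaiYau2009_mixedEnvelope_regular) (hT : 0 < T)
    (hcl : IsClassicalNSSolutionOn (Ico 0 T) 1 0 u p) (hLH : IsLerayHopfOn T 1 0 (u 0) u)
    (hdec : HasRapidSpatialDecay (u 0)) (hax : ∀ t ∈ Ico 0 T, IsAxisymmetric (u t))
    (hΓ : eLpNorm (swirl (u 0)) ∞ volume < ∞)
    (hp : MemLp (uncurry p) (5 / 3)
      (volume.restrict (Ioo 0 T ×ˢ (univ : Set (EuclideanSpace ℝ (Fin 3))))))
    (hrate : ∀ t ∈ Ioo 0 T, ∀ x : EuclideanSpace ℝ (Fin 3), ‖u t x‖ ≤ C / Real.sqrt (T - t))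
    {R : ℝ} (hR : 0 < R) :
    ∃ M : ℝ, ∀ t ∈ Ico 0 T, ∀ x ∈ Metric.ball (0 : EuclideanSpace ℝ (Fin 3)) R, ‖u t x‖ ≤ M :=
  h 1 C T zero_le_one le_rfl hT u p hcl hLH hdec hax hΓ hp (envelope_of_timeRate hrate) R hR

/-- **The axis-bound endpoint** (print's case `ε = 0`, appendix): under the printed hypotheses
and `r |u(x, t)| ≤ C` on `[0, T) × ℝ³`, `u` is bounded on `[0, T) × B_R` for every `R > 0`.
[cite: ChenStrainTsaiYau2009, Thm. 1.1, case ε = 0 (appendix)] -/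
theorem bounded_of_axisBound (h : ChenStrainTsaiYau2009_mixedEnvelope_regular) (hT : 0 < T)
    (hcl : IsClassicalNSSolutionOn (Ico 0 T) 1 0 u p) (hLH : IsLerayHopfOn T 1 0 (u 0) u)
    (hdec : HasRapidSpatialDecay (u 0)) (hax : ∀ t ∈ Ico 0 T, IsAxisymmetric (u t))
    (hΓ : eLpNorm (swirl (u 0)) ∞ volume < ∞)
    (hp : MemLp (uncurry p) (5 / 3)
      (volume.restrict (Ioo 0 T ×ˢ (univ : Set (EuclideanSpace ℝ (Fin 3))))))
    (haxis : ∀ t ∈ Ico 0 T, ∀ x : EuclideanSpace ℝ (Fin 3), cylRadius x * ‖u t x‖ ≤ C)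
    {R : ℝ} (hR : 0 < R) :
    ∃ M : ℝ, ∀ t ∈ Ico 0 T, ∀ x ∈ Metric.ball (0 : EuclideanSpace ℝ (Fin 3)) R, ‖u t x‖ ≤ M :=
  h 0 C T le_rfl zero_le_one hT u p hcl hLH hdec hax hΓ hp (envelope_of_axisBound haxis) R hR

end ChenStrainTsaiYau2009_mixedEnvelope_regular

end Literature.Analysis.FluidPDE
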